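import Literature.MathematicalPhysics.KineticTheory.SiteChainResponsePairing
import HarnessLib

/-!
# Continuity of the Langevin kernels of site-inhomogeneous chains in the bath temperatures

Topic `Literature/MathematicalPhysics/KineticTheory`, grouping namespace `…KineticTheory.HeatConduction`
(model-free part in `…KineticTheory`). The solution map `sdeSolMap Y v₁ v₂ t x w` of an additive-noise
SDE with a confined drift depends on the noise vectors `v₁, v₂` only through the noise path
`pairNoise v₁ v₂ w`, which is affine in them, and the pathwise flow is continuous in the noise path
(Grönwall for the common truncated equation); hence the solution map is continuous in `(v₁, v₂)`
within the noise subspace. For a site-dependent chain the bath temperatures enter only through the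
amplitudes `√(2γT_b)` of `noiseVecL/R`, so:

* `ConfinedDrift.exists_norm_flow_sub_lt` — `‖Φ(x, n₁)(t) - Φ(x, n₂)(t)‖ < ε` on `[0, T]` whenever
  `sup_{[0,T]} ‖n₁ - n₂‖ ≤ η`, uniformly in `V(x) ≤ E₀` and in noise paths bounded by `M`;
* `norm_pairNoise_sub_le`, `ConfinedDrift.tendsto_sdeSolMap_noise` — continuity of the solution map in
  the noise vectors;
* `SiteChain.UniformlyConfining.tendsto_langevinSolMap_temps` — pathwise,
  `Φ^{(T+δ/2, T-δ/2)}_s(x, w) → Φ^{(T,T)}_s(x, w)` as `δ → 0`;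
* `SiteChain.UniformlyConfining.tendsto_integral_cutoff_langevinKernel_temps`,
  `tendsto_integral_langevinKernel_temps` — **the forecasts `δ ↦ P^{(T+δ/2,T-δ/2)}_s φ(x)` are
  continuous at `δ = 0`** for continuous `|φ| ≤ C e^{ϑ'H}`, given an exponential moment bound (EM)
  `∫ e^{ϑH} dP^δ_s(x,·) ≤ K e^{rs} e^{ϑH(x)}` UNIFORM in `|δ| < δ₁` with `ϑ' < ϑ` (bounded truncations
  converge by dominated convergence along the paths; the truncation error is `O(e^{-(ϑ-ϑ')K})`
  uniformly in `δ`).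

## References

* N. Cuneo, J.-P. Eckmann, M. Hairer, L. Rey-Bellet, Electron. J. Probab. **23** (2018) no. 55, §3
  eq. (3.4), Thm 2.13.
* R. Khasminskii, *Stochastic Stability of Differential Equations* (2nd ed., 2012), Thm 3.5.
-/

noncomputable section

open MeasureTheory ProbabilityTheory Filter Topology Set Metric
open scoped NNReal ENNReal

namespace Literature.MathematicalPhysics.KineticTheory

open Literature.Probability.Process Literature.Analysis.ODE

variable {E : Type*} [NormedAddCommGroup E] [NormedSpace ℝ E]

/-! ### The noise path is affine in the noise vectors -/

/-- `‖n_{v₁,v₂}(r) - n_{v₁',v₂'}(r)‖ ≤ |w̄₁(r⁺) - w̄₁(0)| ‖v₁ - v₁'‖ + |w̄₂(r⁺) - w̄₂(0)| ‖v₂ - v₂'‖`. [folklore] -/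
theorem norm_pairNoise_sub_le (v₁ v₂ v₁' v₂' : E) (w : WienerPair) (r : ℝ) :
    ‖pairNoise v₁ v₂ w r - pairNoise v₁' v₂' w r‖ ≤
      |pathRegularize w.1 r.toNNReal - pathRegularize w.1 0| * ‖v₁ - v₁'‖ +
        |pathRegularize w.2 r.toNNReal - pathRegularize w.2 0| * ‖v₂ - v₂'‖ := by
  unfold pairNoise
  have e : (pathRegularize w.1 r.toNNReal - pathRegularize w.1 0) • v₁ +
      (pathRegularize w.2 r.toNNReal - pathRegularize w.2 0) • v₂ -
      ((pathRegularize w.1 r.toNNReal - pathRegularize w.1 0) • v₁' +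
        (pathRegularize w.2 r.toNNReal - pathRegularize w.2 0) • v₂') =
      (pathRegularize w.1 r.toNNReal - pathRegularize w.1 0) • (v₁ - v₁') +
        (pathRegularize w.2 r.toNNReal - pathRegularize w.2 0) • (v₂ - v₂') := by
    simp only [smul_sub]; abel
  rw [e]
  refine (norm_add_le _ _).trans (add_le_add ?_ ?_) <;> rw [norm_smul, Real.norm_eq_abs]

/-- `‖n_{v₁,v₂}(r)‖ ≤ |w̄₁(r⁺) - w̄₁(0)| ‖v₁‖ + |w̄₂(r⁺) - w̄₂(0)| ‖v₂‖`. [folklore] -/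
theorem norm_pairNoise_le (v₁ v₂ : E) (w : WienerPair) (r : ℝ) :
    ‖pairNoise v₁ v₂ w r‖ ≤
      |pathRegularize w.1 r.toNNReal - pathRegularize w.1 0| * ‖v₁‖ +
        |pathRegularize w.2 r.toNNReal - pathRegularize w.2 0| * ‖v₂‖ := by
  have h := norm_pairNoise_sub_le v₁ v₂ 0 0 w r
  have h0 : pairNoise (0 : E) 0 w r = 0 := by simp [pairNoise]
  rwa [h0, sub_zero, sub_zero, sub_zero] at h

/-! ### The flow is continuous in the noise path -/

namespace ConfinedDrift

variable [FiniteDimensional ℝ E] [CompleteSpace E] {Y : E → E} (D : ConfinedDrift Y)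
include D

/-- **Continuous dependence of the flow on the noise path**, locally uniformly: for every energy level
`E₀`, forcing bound `M`, horizon `T` and `ε > 0` there is `η > 0` such that two noise paths (from the
noise subspace, bounded by `M` on `[0, T]`) at sup-distance `≤ η` on `[0, T]` drive every initial
condition with `V(x) ≤ E₀` to states at distance `< ε` on `[0, T]` (both flows are solutions of the
common truncated, globally Lipschitz equation; Grönwall). [folklore] -/
theorem exists_norm_flow_sub_lt (E₀ M T : ℝ) {ε : ℝ} (hε : 0 < ε) :
    ∃ η : ℝ, 0 < η ∧ ∀ x : E, D.V x ≤ E₀ → ∀ n₁ n₂ : ℝ → E, Continuous n₁ → Continuous n₂ →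
      (∀ t, n₁ t ∈ D.noise) → (∀ t, n₂ t ∈ D.noise) →
      (∀ t ∈ Icc 0 T, ‖n₁ t‖ ≤ M) → (∀ t ∈ Icc 0 T, ‖n₂ t‖ ≤ M) →
      (∀ t ∈ Icc 0 T, ‖n₁ t - n₂ t‖ ≤ η) →
      ∀ t ∈ Icc 0 T, ‖drivenFlow Y x n₁ t - drivenFlow Y x n₂ t‖ < ε := by
  set R := max (D.apriori E₀ M T) 1 with hRdef
  have hR : 0 < R := lt_max_of_lt_right one_pos
  obtain ⟨L, hL⟩ := D.exists_lipschitzWith_trunc hR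
  set η : ℝ := ε / 2 / Real.exp (L * max T 0) with hη
  have hη0 : 0 < η := by positivity
  refine ⟨η, hη0, fun x hx n₁ n₂ hn₁ hn₂ hS₁ hS₂ hM₁ hM₂ hclose t ht => ?_⟩
  have hRR : D.apriori (D.V x) M T ≤ R := (D.apriori_mono M T hx).trans (le_max_left _ _)
  rw [D.flow_eqOn_truncSol hR x hn₁ hS₁ hM₁ hRR ht, D.flow_eqOn_truncSol hR x hn₂ hS₂ hM₂ hRR ht]
  unfold drivenTruncSol
  have hlip := norm_forcedSolution_sub_le hL (continuous_const.add hn₁) (continuous_const.add hn₂)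
    (g₁ := fun t => x + n₁ t) (g₂ := fun t => x + n₂ t) (T := T) (δ := η)
    (fun r hr => by simpa using hclose r hr) t ht
  have hexp : Real.exp (L * t) ≤ Real.exp (L * max T 0) :=
    Real.exp_le_exp.2 (mul_le_mul_of_nonneg_left (ht.2.trans (le_max_left _ _)) L.coe_nonneg)
  calc _ ≤ η * Real.exp (L * t) := hlip
    _ ≤ η * Real.exp (L * max T 0) := mul_le_mul_of_nonneg_left hexp hη0.le
    _ = ε / 2 := by rw [hη]; field_simp
    _ < ε := by linarith

/-- **The solution map is continuous in the noise vectors** (within the noise subspace): if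
`v₁(k) → a₁`, `v₂(k) → a₂` along a filter with all vectors in the noise subspace, then
`Φ^{v₁(k),v₂(k)}_t(x, w) → Φ^{a₁,a₂}_t(x, w)` for every `t`, `x` and every pair of raw paths `w`. [folklore] -/
theorem tendsto_sdeSolMap_noise {ι : Type*} {l : Filter ι} {v₁ v₂ : ι → E} {a₁ a₂ : E}
    (hv₁ : ∀ k, v₁ k ∈ D.noise) (hv₂ : ∀ k, v₂ k ∈ D.noise) (ha₁ : a₁ ∈ D.noise) (ha₂ : a₂ ∈ D.noise)
    (h₁ : Tendsto v₁ l (𝓝 a₁)) (h₂ : Tendsto v₂ l (𝓝 a₂)) (t : ℝ) (x : E) (w : WienerPair) :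
    Tendsto (fun k => sdeSolMap Y (v₁ k) (v₂ k) t x w) l (𝓝 (sdeSolMap Y a₁ a₂ t x w)) := by
  rcases le_or_gt t 0 with ht | ht
  · -- nothing moves before time `0`
    unfold sdeSolMap
    simp only [D.flow_of_nonpos x (continuous_pairNoise _ _ w) ht, pairNoise_zero, add_zero]
    exact tendsto_const_nhds
  -- bounds of the two regularised paths on `[0, t]`
  set A : ℝ → ℝ := fun r => pathRegularize w.1 r.toNNReal - pathRegularize w.1 0 with hA
  set B : ℝ → ℝ := fun r => pathRegularize w.2 r.toNNReal - pathRegularize w.2 0 with hB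
  have hAc : Continuous A := (continuous_pathRegularize_toNNReal w.1).sub continuous_const
  have hBc : Continuous B := (continuous_pathRegularize_toNNReal w.2).sub continuous_const
  obtain ⟨Ab, hAb⟩ := isCompact_Icc.exists_bound_of_continuousOn (hAc.continuousOn (s := Icc 0 t))
  obtain ⟨Bb, hBb⟩ := isCompact_Icc.exists_bound_of_continuousOn (hBc.continuousOn (s := Icc 0 t))
  have hAb0 : 0 ≤ Ab := (norm_nonneg _).trans (hAb 0 ⟨le_rfl, ht.le⟩)
  have hBb0 : 0 ≤ Bb := (norm_nonneg _).trans (hBb 0 ⟨le_rfl, ht.le⟩)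
  -- a uniform bound of the noise paths for `v` near `a`
  set M : ℝ := Ab * (‖a₁‖ + 1) + Bb * (‖a₂‖ + 1) with hM
  have hbdd : ∀ u₁ u₂ : E, ‖u₁‖ ≤ ‖a₁‖ + 1 → ‖u₂‖ ≤ ‖a₂‖ + 1 →
      ∀ r ∈ Icc 0 t, ‖pairNoise u₁ u₂ w r‖ ≤ M := by
    intro u₁ u₂ hu₁ hu₂ r hr
    have hAr : |A r| ≤ Ab := Real.norm_eq_abs _ ▸ hAb r hr
    have hBr : |B r| ≤ Bb := Real.norm_eq_abs _ ▸ hBb r hr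
    calc _ ≤ |A r| * ‖u₁‖ + |B r| * ‖u₂‖ := norm_pairNoise_le u₁ u₂ w r
      _ ≤ Ab * (‖a₁‖ + 1) + Bb * (‖a₂‖ + 1) :=
          add_le_add (mul_le_mul hAr hu₁ (norm_nonneg _) hAb0) (mul_le_mul hBr hu₂ (norm_nonneg _) hBb0)
  -- `ε`-`η`
  rw [Metric.tendsto_nhds]
  intro ε hε
  obtain ⟨η, hη0, hflow⟩ := D.exists_norm_flow_sub_lt (D.V x) M t hε
  have hnear₁ : ∀ᶠ k in l, ‖v₁ k - a₁‖ < min 1 (η / 2 / (Ab + 1)) :=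
    (tendsto_iff_norm_sub_tendsto_zero.1 h₁).eventually (Iio_mem_nhds (by positivity))
  have hnear₂ : ∀ᶠ k in l, ‖v₂ k - a₂‖ < min 1 (η / 2 / (Bb + 1)) :=
    (tendsto_iff_norm_sub_tendsto_zero.1 h₂).eventually (Iio_mem_nhds (by positivity))
  filter_upwards [hnear₁, hnear₂] with k hk₁ hk₂
  rw [dist_eq_norm]
  have hk₁1 : ‖v₁ k‖ ≤ ‖a₁‖ + 1 := by
    have := norm_le_norm_add_norm_sub' (v₁ k) a₁
    have h := (lt_min_iff.1 hk₁).1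
    linarith [norm_sub_rev (v₁ k) a₁]
  have hk₂1 : ‖v₂ k‖ ≤ ‖a₂‖ + 1 := by
    have := norm_le_norm_add_norm_sub' (v₂ k) a₂
    have h := (lt_min_iff.1 hk₂).1
    linarith [norm_sub_rev (v₂ k) a₂]
  refine hflow x le_rfl _ _ (continuous_pairNoise _ _ w) (continuous_pairNoise _ _ w)
    (fun r => pairNoise_mem _ _ (hv₁ k) (hv₂ k) w r) (fun r => pairNoise_mem _ _ ha₁ ha₂ w r)
    (hbdd _ _ hk₁1 hk₂1) (hbdd _ _ (by linarith [norm_nonneg a₁]) (by linarith [norm_nonneg a₂]))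
    (fun r hr => ?_) t ⟨ht.le, le_rfl⟩
  have hAr : |A r| ≤ Ab := Real.norm_eq_abs _ ▸ hAb r hr
  have hBr : |B r| ≤ Bb := Real.norm_eq_abs _ ▸ hBb r hr
  have h1 : |A r| * ‖v₁ k - a₁‖ ≤ η / 2 := by
    have hlt : ‖v₁ k - a₁‖ < η / 2 / (Ab + 1) := (lt_min_iff.1 hk₁).2
    calc |A r| * ‖v₁ k - a₁‖ ≤ Ab * (η / 2 / (Ab + 1)) := mul_le_mul hAr hlt.le (norm_nonneg _) hAb0
      _ ≤ (Ab + 1) * (η / 2 / (Ab + 1)) := mul_le_mul_of_nonneg_right (by linarith) (by positivity)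
      _ = η / 2 := by field_simp
  have h2 : |B r| * ‖v₂ k - a₂‖ ≤ η / 2 := by
    have hlt : ‖v₂ k - a₂‖ < η / 2 / (Bb + 1) := (lt_min_iff.1 hk₂).2
    calc |B r| * ‖v₂ k - a₂‖ ≤ Bb * (η / 2 / (Bb + 1)) := mul_le_mul hBr hlt.le (norm_nonneg _) hBb0
      _ ≤ (Bb + 1) * (η / 2 / (Bb + 1)) := mul_le_mul_of_nonneg_right (by linarith) (by positivity)
      _ = η / 2 := by field_simp
  calc _ ≤ |A r| * ‖v₁ k - a₁‖ + |B r| * ‖v₂ k - a₂‖ := norm_pairNoise_sub_le _ _ _ _ w r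
    _ ≤ η / 2 + η / 2 := add_le_add h1 h2
    _ = η := by ring

end ConfinedDrift

end Literature.MathematicalPhysics.KineticTheory

namespace Literature.MathematicalPhysics.KineticTheory.HeatConduction

open Literature.Probability.Process Literature.MathematicalPhysics.KineticTheory

variable {N : ℕ}

namespace SiteChain.UniformlyConfining

variable {P : SiteChain} (hP : P.UniformlyConfining) (N : ℕ) (T : ℝ)
include hP

/-! ### Pathwise continuity of the Langevin solution map in the bath temperatures -/

/-- **The solution map of a site-dependent chain is continuous in the bath temperatures along the
anti-diagonal**, pathwise: `Φ^{(T+δ/2, T-δ/2)}_s(x, w) → Φ^{(T,T)}_s(x, w)` as `δ → 0`, for every raw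
path pair `w` (the amplitudes `√(2γ(T ± δ/2))` are continuous in `δ`). [folklore] -/
theorem tendsto_langevinSolMap_temps (s : ℝ) (x : PhaseSpace N) (w : WienerPair) :
    Tendsto (fun δ : ℝ => P.langevinSolMap N (T + δ / 2) (T - δ / 2) s x w) (𝓝 0)
      (𝓝 (P.langevinSolMap N T T s x w)) := by
  have hcL : Tendsto (fun δ : ℝ => P.noiseVecL N (T + δ / 2)) (𝓝 0) (𝓝 (P.noiseVecL N T)) := by
    have hc : Continuous fun δ : ℝ => P.noiseVecL N (T + δ / 2) := by
      unfold SiteChain.noiseVecL bathVec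
      refine continuous_const.prodMk (continuous_pi fun i => ?_)
      split_ifs
      · exact Real.continuous_sqrt.comp (by fun_prop)
      · exact continuous_const
    simpa using hc.tendsto 0
  have hcR : Tendsto (fun δ : ℝ => P.noiseVecR N (T - δ / 2)) (𝓝 0) (𝓝 (P.noiseVecR N T)) := by
    have hc : Continuous fun δ : ℝ => P.noiseVecR N (T - δ / 2) := by
      unfold SiteChain.noiseVecR bathVec
      refine continuous_const.prodMk (continuous_pi fun i => ?_)
      split_ifs
      · exact Real.continuous_sqrt.comp (by fun_prop)
      · exact continuous_const
    simpa using hc.tendsto 0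
  exact (hP.confinedDrift N).toConfinedDrift.tendsto_sdeSolMap_noise (fun δ => hP.noiseVecL_mem_noise N _)
    (fun δ => hP.noiseVecR_mem_noise N _) (hP.noiseVecL_mem_noise N T) (hP.noiseVecR_mem_noise N T) hcL hcR s x w

/-! ### Continuity of the forecasts in the bath temperatures -/

variable {N T} {φ : PhaseSpace N → ℝ} (hφc : Continuous φ)
include hφc

/-- **Forecasts of bounded energy truncations are continuous in the bath temperatures**:
`δ ↦ P^{(T+δ/2,T-δ/2)}_s (χ(H/L) φ)(x)` is continuous at `0` (`L > 0`; dominated convergence along the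
paths, the truncated observable being bounded). [folklore] -/
theorem tendsto_integral_cutoff_langevinKernel_temps (s : ℝ≥0) (x : PhaseSpace N) {L : ℝ} (hL : 0 < L) :
    Tendsto (fun δ : ℝ => ∫ y, smoothCutoff (P.hamiltonian N y / L) * φ y
        ∂(P.langevinKernel N (T + δ / 2) (T - δ / 2) s x)) (𝓝 0)
      (𝓝 (∫ y, smoothCutoff (P.hamiltonian N y / L) * φ y ∂(P.langevinKernel N T T s x))) := by
  have hgc : Continuous fun y : PhaseSpace N => smoothCutoff (P.hamiltonian N y / L) * φ y :=
    ((contDiff_smoothCutoff (n := 0)).continuous.comp ((hP.contDiff_hamiltonian N).continuous.div_const L)).mul hφc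
  have hgs : HasCompactSupport fun y : PhaseSpace N => smoothCutoff (P.hamiltonian N y / L) * φ y := by
    refine HasCompactSupport.intro (hP.isCompact_setOf_hamiltonian_le N (2 * L)) fun y hy => ?_
    simp only [Set.mem_setOf_eq, not_le] at hy
    rw [smoothCutoff_of_two_le ((le_div_iff₀ hL).2 hy.le), zero_mul]
  obtain ⟨B, hB⟩ := hgc.bounded_above_of_compact_support hgs
  have heq : ∀ T_L T_R : ℝ, ∫ y, smoothCutoff (P.hamiltonian N y / L) * φ y ∂(P.langevinKernel N T_L T_R s x) =
      ∫ ω, (fun y => smoothCutoff (P.hamiltonian N y / L) * φ y) (P.langevinSolMap N T_L T_R s x (pairPath ω)) ∂wienerPair :=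
    fun T_L T_R => hP.integral_langevinKernel N T_L T_R s x hgc.aestronglyMeasurable
  simp_rw [heq]
  refine tendsto_integral_filter_of_dominated_convergence (fun _ => B)
    (Eventually.of_forall fun δ => (hgc.measurable.comp
      (hP.measurable_langevinSolMap_pairPath_right N _ _ s x)).aestronglyMeasurable)
    (Eventually.of_forall fun δ => Eventually.of_forall fun ω => hB _) (integrable_const B)
    (Eventually.of_forall fun ω => ?_)
  exact (hgc.tendsto _).comp (hP.tendsto_langevinSolMap_temps N T s x (pairPath ω))

variable {ϑ ϑ' K r δ₁ C : ℝ} (hδ₁ : 0 < δ₁) (hϑ' : ϑ' < ϑ) (hK0 : 0 ≤ K) (hr : 0 ≤ r)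
  (hKu : ∀ δ : ℝ, |δ| < δ₁ → ∀ (t : ℝ≥0) (x : PhaseSpace N),
    ∫⁻ y, ENNReal.ofReal (Real.exp (ϑ * P.hamiltonian N y)) ∂(P.langevinKernel N (T + δ / 2) (T - δ / 2) t x) ≤
      ENNReal.ofReal (K * Real.exp (r * t) * Real.exp (ϑ * P.hamiltonian N x)))
  (hφ : ∀ y, |φ y| ≤ C * Real.exp (ϑ' * P.hamiltonian N y))
include hδ₁ hϑ' hK0 hKu hφ

/-- **The forecasts are continuous in the bath temperatures**: under an exponential moment bound (EM)
uniform in `|δ| < δ₁`, for continuous `φ` with `|φ| ≤ C e^{ϑ'H}`, `ϑ' < ϑ`, and every `s ≥ 0`, `x`,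
`δ ↦ P^{(T+δ/2,T-δ/2)}_s φ(x)` is continuous at `δ = 0` (a `3ε`-argument: truncate at energy `L`, the
truncation error being `≤ C K e^{rs} e^{ϑH(x)} e^{-(ϑ-ϑ')L}` uniformly in `δ`).
[cite: CuneoEckmannHairerReyBellet2018, Thm 2.13] -/
theorem tendsto_integral_langevinKernel_temps (s : ℝ≥0) (x : PhaseSpace N) :
    Tendsto (fun δ : ℝ => ∫ y, φ y ∂(P.langevinKernel N (T + δ / 2) (T - δ / 2) s x)) (𝓝 0)
      (𝓝 (∫ y, φ y ∂(P.langevinKernel N T T s x))) := by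
  have hHc : Continuous (P.hamiltonian N) := (hP.contDiff_hamiltonian N).continuous
  have hsc : Continuous smoothCutoff := (contDiff_smoothCutoff (n := 0)).continuous
  have hC : 0 ≤ C := by
    have := (abs_nonneg _).trans (hφ 0)
    exact nonneg_of_mul_nonneg_left this (Real.exp_pos _)
  have hH0 := hP.hamiltonian_nonneg N
  -- `|φ| ≤ C e^{ϑH}` as well
  have hφϑ : ∀ y, |φ y| ≤ C * Real.exp (ϑ * P.hamiltonian N y) := fun y =>
    (hφ y).trans (mul_le_mul_of_nonneg_left (Real.exp_le_exp.2 (mul_le_mul_of_nonneg_right hϑ'.le (hH0 y))) hC)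
  -- the truncation error, uniformly in `|δ| < δ₁`
  have htail : ∀ (L : ℝ), 0 < L → ∀ δ : ℝ, |δ| < δ₁ →
      |(∫ y, φ y ∂(P.langevinKernel N (T + δ / 2) (T - δ / 2) s x)) -
        ∫ y, smoothCutoff (P.hamiltonian N y / L) * φ y ∂(P.langevinKernel N (T + δ / 2) (T - δ / 2) s x)| ≤
        C * Real.exp (-(ϑ - ϑ') * L) * (K * Real.exp (r * s) * Real.exp (ϑ * P.hamiltonian N x)) := by
    intro L hL δ hδ
    have hK := hKu δ hδ
    have hIφ := hP.integrable_langevinKernel_of_abs_le hK hφc hφϑ s x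
    have hgc : Continuous fun y : PhaseSpace N => smoothCutoff (P.hamiltonian N y / L) * φ y :=
      (hsc.comp (hHc.div_const L)).mul hφc
    have hIg : Integrable (fun y => smoothCutoff (P.hamiltonian N y / L) * φ y)
        (P.langevinKernel N (T + δ / 2) (T - δ / 2) s x) :=
      hIφ.mono hgc.aestronglyMeasurable (Eventually.of_forall fun y => by
        rw [Real.norm_eq_abs, Real.norm_eq_abs, abs_mul, abs_of_nonneg (smoothCutoff_nonneg _)]
        exact mul_le_of_le_one_left (abs_nonneg _) (smoothCutoff_le_one _))
    have hI2 := hP.integrable_exp_langevinKernel hK s x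
    rw [← integral_sub hIφ hIg]
    -- pointwise: `|φ - χ(H/L)φ| ≤ C e^{-(ϑ-ϑ')L} e^{ϑH}`
    have hpt : ∀ y : PhaseSpace N, |φ y - smoothCutoff (P.hamiltonian N y / L) * φ y| ≤
        C * Real.exp (-(ϑ - ϑ') * L) * Real.exp (ϑ * P.hamiltonian N y) := by
      intro y
      set Hy := P.hamiltonian N y
      rcases le_or_gt Hy L with hle | hlt
      · rw [smoothCutoff_of_le_one ((div_le_one hL).2 hle), one_mul, sub_self, abs_zero]
        positivity
      · have h1 : |φ y - smoothCutoff (Hy / L) * φ y| ≤ |φ y| := by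
          rw [show φ y - smoothCutoff (Hy / L) * φ y = (1 - smoothCutoff (Hy / L)) * φ y by ring,
            abs_mul, abs_of_nonneg (by linarith [smoothCutoff_le_one (Hy / L)])]
          exact mul_le_of_le_one_left (abs_nonneg _) (by linarith [smoothCutoff_nonneg (Hy / L)])
        have h2 : Real.exp (ϑ' * Hy) ≤ Real.exp (-(ϑ - ϑ') * L) * Real.exp (ϑ * Hy) := by
          rw [← Real.exp_add]
          exact Real.exp_le_exp.2 (by nlinarith)
        calc _ ≤ |φ y| := h1
          _ ≤ C * Real.exp (ϑ' * Hy) := hφ y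
          _ ≤ C * (Real.exp (-(ϑ - ϑ') * L) * Real.exp (ϑ * Hy)) := mul_le_mul_of_nonneg_left h2 hC
          _ = _ := by ring
    have hb := hP.integral_exp_langevinKernel_le hK hK0 s x
    calc _ ≤ ∫ y, C * Real.exp (-(ϑ - ϑ') * L) * Real.exp (ϑ * P.hamiltonian N y)
          ∂(P.langevinKernel N (T + δ / 2) (T - δ / 2) s x) := by
          rw [← Real.norm_eq_abs]
          exact norm_integral_le_of_norm_le (hI2.const_mul _) (Eventually.of_forall fun y => by
            rw [Real.norm_eq_abs]; exact hpt y)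
      _ = C * Real.exp (-(ϑ - ϑ') * L) * ∫ y, Real.exp (ϑ * P.hamiltonian N y)
          ∂(P.langevinKernel N (T + δ / 2) (T - δ / 2) s x) := integral_const_mul _ _
      _ ≤ _ := mul_le_mul_of_nonneg_left hb (by positivity)
  -- `3ε`
  rw [Metric.tendsto_nhds]
  intro ε hε
  set W : ℝ := K * Real.exp (r * s) * Real.exp (ϑ * P.hamiltonian N x) with hW
  have hW0 : 0 ≤ W := by positivity
  -- choose the truncation level
  obtain ⟨L, hL0, hL⟩ : ∃ L : ℝ, 0 < L ∧ C * Real.exp (-(ϑ - ϑ') * L) * W < ε / 3 := by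
    have h1 : Tendsto (fun L : ℝ => -(ϑ - ϑ') * L) atTop atBot :=
      tendsto_id.const_mul_atTop_of_neg (by linarith : -(ϑ - ϑ') < 0)
    have h2 : Tendsto (fun L : ℝ => Real.exp (-(ϑ - ϑ') * L)) atTop (𝓝 0) := Real.tendsto_exp_atBot.comp h1
    have h : Tendsto (fun L : ℝ => C * Real.exp (-(ϑ - ϑ') * L) * W) atTop (𝓝 (C * 0 * W)) :=
      (h2.const_mul C).mul_const W
    rw [mul_zero, zero_mul] at h
    obtain ⟨L, hL⟩ := ((h.eventually (Iio_mem_nhds (by positivity : (0:ℝ) < ε / 3))).and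
      (eventually_gt_atTop 0)).exists
    exact ⟨L, hL.2, hL.1⟩
  have hmid := hP.tendsto_integral_cutoff_langevinKernel_temps hφc s x hL0 (T := T)
  rw [Metric.tendsto_nhds] at hmid
  have hball : ∀ᶠ δ in 𝓝 (0 : ℝ), |δ| < δ₁ := by
    have : Metric.ball (0 : ℝ) δ₁ ∈ 𝓝 (0 : ℝ) := Metric.ball_mem_nhds 0 hδ₁
    filter_upwards [this] with δ hδ
    simpa [Real.dist_eq] using hδ
  filter_upwards [hmid (ε / 3) (by positivity), hball] with δ hδm hδ1
  have h1 := htail L hL0 δ hδ1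
  have h0 := htail L hL0 0 (by simpa using hδ₁)
  simp only [zero_div, add_zero, sub_zero] at h0
  rw [Real.dist_eq] at hδm ⊢
  -- triangle inequality
  have key : ∀ (a b c' d : ℝ), |a - b| ≤ ε / 3 → |b - c'| < ε / 3 → |d - c'| ≤ ε / 3 → |a - d| < ε := by
    intro a b c' d h1 h2 h3
    have := abs_sub_le a b d
    have := abs_sub_le b c' d
    rw [abs_sub_comm d c'] at h3
    linarith
  exact key _ _ _ _ (h1.trans hL.le) hδm (h0.trans hL.le)

end SiteChain.UniformlyConfining

end Literature.MathematicalPhysics.KineticTheory.HeatConduction
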